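import Summits.CriticalPhenomena.PercolationContinuityZ3.Theses.PercNonProliferation
import Literature.Barriers.CriticalPhenomena.SpanningClustersAboveSix
import Literature.Probability.Percolation.FiniteEnergy
import Literature.Probability.Percolation.SharpnessDCTProofs
import HarnessLib

/-!
# Crux `PercNonProliferation.NonProliferation` (stmt-CriticalPhenomena-4444), line `birth-merge-ledger` — stub `stub_screening`

Helper file for the lead's skeleton of line `birth-merge-ledger`
(`Cruxes/NonProliferation/Lines/birth_merge_ledger.lean`, prover-line-stmt-CriticalPhenomena-4444-0).
Proves exactly the registered stub signature `stub_screening`; lands with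
`--supports stmt-CriticalPhenomena-4444`.

**Screening inequality** `(1 - P(A)) · P(birth_e) ≤ P(e pivotal for A)` for
`A = annulusCrossing d n` and an edge `e = {x, y}` of `B = Λ_{2n}`. Argument (exploration
decomposition à la Grimmett, *Percolation* (1999), §10.3, and Hutchcroft, J. Stat. Phys. 189
(2022), §2; cf. `ClusterBoundary.lean`), all inside `oriented`: fix an orientation and the values
`q = (I, O)` of the `B`-clusters of `x`, `y` read in `ω ∖ {e}`; the piece
`Pc q = {C_B(x) = I, C_B(y) = O}` is determined by the pairs `T q` of `B` touching `I ∪ O`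
(`cl_of_inter_eq`), the screening event `Fev q` = "no open crossing along the pairs `R q` touching
neither" is determined by `R q`, hence independent of the piece
(`bondPercolation_real_inter_of_disjoint`), and has probability `≥ 1 - P(A)` (crossings are
increasing); on `Fev q ∩ Pc q` the edge `e` is pivotal for `A` — opening `e` joins
`Λ_n ∋ v ↔ x – y ↔ w ∈ ∂ⁱⁿΛ_{2n}`, while an open crossing of `ω ∖ {e}` would run inside `I` (which
misses the boundary), start in `O` (which misses `Λ_n`), or avoid both (excluded by `Fev q`).
Summing over the finitely many disjoint pieces and then over the two disjoint orientations
(`final`) gives the claim. No new definitions: the events are local `set`s of the proofs, and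
the crossing event enters through a membership characterisation `hA`, which
`annulusCrossing d n` satisfies by `Iff.rfl`.
-/

noncomputable section

namespace Summit.CriticalPhenomena.PercolationContinuityZ3.Theorems.NonProliferation

open MeasureTheory
open Literature.Probability.LatticeModels Literature.Probability.Percolation
open Literature.Barriers.CriticalPhenomena

namespace StubScreening

variable {V : Type*} {B In Bd : Finset V}

/-- The endpoint of a witnessed connection inside `S` lies in `S`. -/
theorem mem_of_mem_openConnIn {S : Set V} {a b : V} {σ : BondConfig V}
    (h : σ ∈ openConnIn S a b) : b ∈ S := by
  obtain ⟨-, hb, -⟩ := h; exact hb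

/-- A box-cluster `I = {z ∈ B | σ ∈ {r ↔ z in B}}` (given by its membership characterisation) is
closed under open pairs inside the box. -/
theorem cl_closed {σ : BondConfig V} {r a b : V} {I : Finset V}
    (hI : ∀ z, z ∈ I ↔ z ∈ B ∧ σ ∈ openConnIn (↑B : Set V) r z) (ha : a ∈ I) (hb : b ∈ B)
    (hab : s(a, b) ∈ σ) (hne : a ≠ b) : b ∈ I :=
  (hI b).2 ⟨hb, PlanarDuality.openConnIn_trans ((hI a).1 ha).2
    (openConnIn_of_adj (Finset.mem_coe.2 ((hI a).1 ha).1) (Finset.mem_coe.2 hb) hab hne)⟩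

/-- **Locality of `{C_B(r) = I}`**: if two configurations agree on a set of pairs `K` containing
every pair of `B` with an endpoint in `I`, and the box-cluster of `r ∈ B` is `I` in the first, then
it is `I` in the second (cf. `DCT16.determinedBy_clusterEvent`). -/
theorem cl_of_inter_eq {I : Finset V} {r : V} (hr : r ∈ B) {K : Set (Sym2 V)}
    (hK : ∀ a b, a ∈ B → b ∈ B → a ∈ I → s(a, b) ∈ K) {σ σ' : BondConfig V}
    (hag : σ ∩ K = σ' ∩ K) (hI : ∀ z, z ∈ I ↔ z ∈ B ∧ σ ∈ openConnIn (↑B : Set V) r z) :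
    ∀ z, z ∈ I ↔ z ∈ B ∧ σ' ∈ openConnIn (↑B : Set V) r z := by
  intro z
  constructor
  · intro hzI
    obtain ⟨hzB, hz⟩ := (hI z).1 hzI
    have hp := DCT16.pathIn_restrict_cluster (DCT16.pathIn_of_mem_openConnIn hz)
    refine ⟨hzB, DCT16.mem_openConnIn_of_pathIn
      ((DCT16.pathIn_congrGraph (G' := openGraph σ') ?_ hp).mono Set.inter_subset_left)⟩
    intro a b ha hb hab
    have haI : a ∈ I := (hI a).2 ⟨ha.1, DCT16.mem_openConnIn_of_pathIn ha.2⟩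
    exact (DCT16.openGraph_adj_congr hag (hK a b ha.1 hb.1 haI)).1 hab
  · rintro ⟨-, hz⟩
    refine DCT16.pathIn_induction (fun w => w ∈ I) (DCT16.pathIn_of_mem_openConnIn hz) ?_ ?_
    · exact (hI r).2 ⟨hr, openConnIn_refl (Finset.mem_coe.2 hr)⟩
    · intro a b haB hbB haI hab
      have hab' : (openGraph σ).Adj a b :=
        (DCT16.openGraph_adj_congr hag (hK a b haB hbB haI)).2 hab
      exact cl_closed hI haI hbB ((openGraph_adj σ a b).1 hab').1 ((openGraph_adj σ a b).1 hab').2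

/-- Agreement on `K` passes to the configurations with a set of pairs removed. -/
theorem sdiff_inter_eq {ω ω' K : Set (Sym2 V)} (E : Set (Sym2 V)) (h : ω ∩ K = ω' ∩ K) :
    (ω \ E) ∩ K = (ω' \ E) ∩ K := by
  rw [Set.sdiff_eq, Set.sdiff_eq, Set.inter_right_comm, h, Set.inter_right_comm]

/-- Configurations agreeing on the pairs of `B` have the same connections inside `B`. -/
theorem openConnIn_iff_of_inter_eq {σ σ' : BondConfig V} (h : σ ∩ ↑B.sym2 = σ' ∩ ↑B.sym2)
    (a b : V) : σ ∈ openConnIn (↑B : Set V) a b ↔ σ' ∈ openConnIn (↑B : Set V) a b :=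
  (determinedBy_iff _ _).1 (PlanarDuality.determinedBy_openConnIn B a b) σ σ' h

/-- The oriented birth event (read without `e`) is determined by the pairs of `B`. -/
theorem determinedBy_birth (e : Sym2 V) (x y : V) :
    DeterminedBy {ω : BondConfig V | (∃ v ∈ In, ω \ {e} ∈ openConnIn (↑B : Set V) x v) ∧
      (∀ w ∈ Bd, ω \ {e} ∉ openConnIn (↑B : Set V) x w) ∧
      (∃ w ∈ Bd, ω \ {e} ∈ openConnIn (↑B : Set V) y w) ∧
      (∀ v ∈ In, ω \ {e} ∉ openConnIn (↑B : Set V) y v)} (↑B.sym2 : Set (Sym2 V)) := by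
  rw [determinedBy_iff]
  intro ω ω' h
  simp only [Set.mem_setOf_eq, openConnIn_iff_of_inter_eq (sdiff_inter_eq {e} h)]

variable [Countable V] (G : SimpleGraph V) (p : unitInterval) {x y : V}

/-- **The oriented screening inequality** `(1 - P(A)) · P(S) ≤ P({e pivotal for A} ∩ S)` for the
crossing event `A = {In ↔ Bd in B}` (entered through its membership characterisation `hA`) and
the oriented birth event `S` of the edge `e = {x, y}` (through `hS`): decompose `S` along the
values `q = (I, O)` of the two explored clusters (`Pc q`), screen with the free-pair event `Fev q`
(independent of `Pc q`, probability `≥ 1 - P(A)`), observe that `e` is pivotal on `Fev q ∩ Pc q`,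
and sum over `q`. -/
theorem oriented {e : Sym2 V} (he : e = s(x, y)) (hx : x ∈ B) (hy : y ∈ B) (hxy : x ≠ y)
    {A S : Set (BondConfig V)}
    (hA : ∀ ω, ω ∈ A ↔ ∃ a ∈ In, ∃ b ∈ Bd, ω ∈ openConnIn (↑B : Set V) a b)
    (hS : ∀ ω, ω ∈ S ↔ (∃ v ∈ In, ω \ {e} ∈ openConnIn (↑B : Set V) x v) ∧
      (∀ w ∈ Bd, ω \ {e} ∉ openConnIn (↑B : Set V) x w) ∧
      (∃ w ∈ Bd, ω \ {e} ∈ openConnIn (↑B : Set V) y w) ∧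
      (∀ v ∈ In, ω \ {e} ∉ openConnIn (↑B : Set V) y v)) :
    (1 - (bondPercolation G p).real A) * (bondPercolation G p).real S ≤
      (bondPercolation G p).real ({ω | IsPivotal A e ω} ∩ S) := by
  classical
  set μ := bondPercolation G p
  -- the explored piece, touching and free pairs, the screening event, birth pairs, index set
  set Pc : Finset V × Finset V → Set (BondConfig V) := fun q =>
    {ω | (∀ z, z ∈ q.1 ↔ z ∈ B ∧ ω \ {e} ∈ openConnIn (↑B : Set V) x z) ∧
      (∀ z, z ∈ q.2 ↔ z ∈ B ∧ ω \ {e} ∈ openConnIn (↑B : Set V) y z)}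
  set T : Finset V × Finset V → Set (Sym2 V) := fun q =>
    {f | f ∈ B.sym2 ∧ ∃ z ∈ f, z ∈ q.1 ∨ z ∈ q.2}
  set R : Finset V × Finset V → Set (Sym2 V) := fun q =>
    {f | f ∈ B.sym2 ∧ ∀ z ∈ f, z ∉ q.1 ∧ z ∉ q.2}
  set Fev : Finset V × Finset V → Set (BondConfig V) := fun q =>
    {ω | ∀ a ∈ In, ∀ b ∈ Bd, ω ∩ R q ∉ openConnIn (↑B : Set V) a b}
  set BP : Finset V × Finset V → Prop := fun q =>
    (∃ v ∈ In, v ∈ q.1) ∧ (∀ w ∈ Bd, w ∉ q.1) ∧ (∃ w ∈ Bd, w ∈ q.2) ∧ (∀ v ∈ In, v ∉ q.2)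
  set D : Finset (Finset V × Finset V) := (B.powerset ×ˢ B.powerset).filter BP
  -- locality, measurability, independence
  have hAm : MeasurableSet A := by
    refine DeterminedBy.measurableSet_of_finset (F := B.sym2)
      ((determinedBy_iff _ _).2 fun σ σ' h => ?_)
    simp only [hA, openConnIn_iff_of_inter_eq h]
  have hPdet : ∀ q, DeterminedBy (Pc q) (T q) := fun q => by
    have hK1 : ∀ a b, a ∈ B → b ∈ B → a ∈ q.1 → s(a, b) ∈ T q := fun a b ha hb haI =>
      ⟨Finset.mk_mem_sym2_iff.2 ⟨ha, hb⟩, a, Sym2.mem_mk_left a b, Or.inl haI⟩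
    have hK2 : ∀ a b, a ∈ B → b ∈ B → a ∈ q.2 → s(a, b) ∈ T q := fun a b ha hb haO =>
      ⟨Finset.mk_mem_sym2_iff.2 ⟨ha, hb⟩, a, Sym2.mem_mk_left a b, Or.inr haO⟩
    rw [determinedBy_iff]
    suffices key : ∀ ω ω' : BondConfig V, ω ∩ T q = ω' ∩ T q → ω ∈ Pc q → ω' ∈ Pc q from
      fun ω ω' h => ⟨key ω ω' h, key ω' ω h.symm⟩
    rintro ω ω' h ⟨hI, hO⟩
    have h' := sdiff_inter_eq {e} h
    exact ⟨cl_of_inter_eq hx hK1 h' hI, cl_of_inter_eq hy hK2 h' hO⟩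
  have hFdet : ∀ q, DeterminedBy (Fev q) (R q) := fun q => by
    rw [determinedBy_iff]
    intro ω ω' h
    simp only [Fev, Set.mem_setOf_eq, h]
  have hPm : ∀ q, MeasurableSet (Pc q) := fun q =>
    ((hPdet q).mono (fun _ hf => hf.1 : T q ⊆ ↑B.sym2)).measurableSet_of_finset
  have hFm : ∀ q, MeasurableSet (Fev q) := fun q =>
    ((hFdet q).mono (fun _ hf => hf.1 : R q ⊆ ↑B.sym2)).measurableSet_of_finset
  have hFge : ∀ q, 1 - μ.real A ≤ μ.real (Fev q) := fun q => by
    rw [← probReal_compl_eq_one_sub hAm]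
    exact measureReal_mono fun ω hω a ha b hb h => hω ((hA ω).2 ⟨a, ha, b, hb,
      isUpperSet_openConnIn _ a b (Set.inter_subset_left : ω ∩ R q ⊆ ω) h⟩)
  have hRT : ∀ q, Disjoint (R q) (T q) := fun q =>
    Set.disjoint_left.2 fun _ ⟨_, hf⟩ ⟨_, z, hz, hzq⟩ => hzq.elim (hf z hz).1 (hf z hz).2
  have hind : ∀ q, μ.real (Fev q ∩ Pc q) = μ.real (Fev q) * μ.real (Pc q) := fun q =>
    bondPercolation_real_inter_of_disjoint G p (hRT q) (hFdet q) (hPdet q) (hFm q) (hPm q)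
  have hdisj : Set.PairwiseDisjoint (↑D : Set (Finset V × Finset V)) (fun q => Fev q ∩ Pc q) :=
    fun q _ q' _ hne => Set.disjoint_left.2 fun ω ⟨_, hI, hO⟩ ⟨_, hI', hO'⟩ =>
      hne (Prod.ext (Finset.ext fun z => (hI z).trans (hI' z).symm)
        (Finset.ext fun z => (hO z).trans (hO' z).symm))
  -- `S` is covered by the pieces of the birth pairs (take the two explored clusters)
  have hcover : S ⊆ ⋃ q ∈ D, Pc q := fun ω hω => by
    obtain ⟨⟨v, hvIn, hv⟩, h2, ⟨w, hwBd, hw⟩, h4⟩ := (hS ω).1 hω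
    refine Set.mem_iUnion₂.2 ⟨(B.filter fun z => ω \ {e} ∈ openConnIn (↑B : Set V) x z,
      B.filter fun z => ω \ {e} ∈ openConnIn (↑B : Set V) y z), Finset.mem_filter.2
        ⟨Finset.mem_product.2 ⟨Finset.mem_powerset.2 (Finset.filter_subset _ _),
          Finset.mem_powerset.2 (Finset.filter_subset _ _)⟩, ?_⟩,
      fun z => Finset.mem_filter, fun z => Finset.mem_filter⟩
    simp only [BP, Finset.mem_filter]
    exact ⟨⟨v, hvIn, mem_of_mem_openConnIn hv, hv⟩, fun w' hw' h => h2 w' hw' h.2,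
      ⟨w, hwBd, mem_of_mem_openConnIn hw, hw⟩, fun v' hv' h => h4 v' hv' h.2⟩
  -- the pointwise heart: on `Fev q ∩ Pc q` (`q` a birth pair) `e` is pivotal, and `Pc q ⊆ S`
  have hsub : (⋃ q ∈ D, Fev q ∩ Pc q) ⊆ {ω | IsPivotal A e ω} ∩ S := by
    refine Set.iUnion₂_subset fun q hq => ?_
    obtain ⟨⟨v, hvIn, hvI⟩, hIBd, ⟨w, hwBd, hwO⟩, hOIn⟩ := (Finset.mem_filter.1 hq).2
    rintro ω ⟨hF, hI, hO⟩
    refine ⟨Or.inl ⟨(hA _).2 ?_, fun hA' => ?_⟩, (hS ω).2 ⟨⟨v, hvIn, ((hI v).1 hvI).2⟩,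
      fun w' hw' h => hIBd w' hw' ((hI w').2 ⟨mem_of_mem_openConnIn h, h⟩),
      ⟨w, hwBd, ((hO w).1 hwO).2⟩,
      fun v' hv' h => hOIn v' hv' ((hO v').2 ⟨mem_of_mem_openConnIn h, h⟩)⟩⟩
    · -- opening `e` creates the crossing `v ↔ x – y ↔ w`
      have hsub : ω \ {e} ⊆ insert e ω := Set.sdiff_subset.trans (Set.subset_insert e ω)
      have hxv : insert e ω ∈ openConnIn (↑B : Set V) x v :=
        isUpperSet_openConnIn _ x v hsub ((hI v).1 hvI).2
      have hyw : insert e ω ∈ openConnIn (↑B : Set V) y w :=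
        isUpperSet_openConnIn _ y w hsub ((hO w).1 hwO).2
      have hexy : insert e ω ∈ openConnIn (↑B : Set V) x y :=
        openConnIn_of_adj (Finset.mem_coe.2 hx) (Finset.mem_coe.2 hy) (he ▸ Set.mem_insert e ω) hxy
      refine ⟨v, hvIn, w, hwBd, ?_⟩
      rw [openConnIn_comm] at hxv
      exact PlanarDuality.openConnIn_trans hxv (PlanarDuality.openConnIn_trans hexy hyw)
    · -- without `e` there is no crossing
      obtain ⟨a, ha, b, hb, hab⟩ := (hA _).1 hA'
      have hpath := DCT16.pathIn_of_mem_openConnIn hab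
      by_cases haI : a ∈ q.1
      · refine hIBd b hb (DCT16.pathIn_induction (fun z => z ∈ q.1) hpath haI ?_)
        intro z z' _ hz' hzI hadj
        exact cl_closed hI hzI hz' ((openGraph_adj _ z z').1 hadj).1 ((openGraph_adj _ z z').1 hadj).2
      · have key := DCT16.pathIn_induction
          (fun z => z ∉ q.1 ∧ z ∉ q.2 ∧ PathIn (openGraph (ω ∩ R q)) (↑B : Set V) a z)
          hpath ⟨haI, hOIn a ha, PathIn.refl hpath.left_mem⟩ ?_
        · exact hF a ha b hb (DCT16.mem_openConnIn_of_pathIn key.2.2)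
        · rintro z z' hz hz' ⟨hzI, hzO, hp⟩ hadj
          obtain ⟨hmem, hne⟩ := (openGraph_adj _ z z').1 hadj
          have hmem' : s(z', z) ∈ ω \ {e} := by rw [Sym2.eq_swap]; exact hmem
          have hz'I : z' ∉ q.1 := fun h => hzI (cl_closed hI h hz hmem' hne.symm)
          have hz'O : z' ∉ q.2 := fun h => hzO (cl_closed hO h hz hmem' hne.symm)
          refine ⟨hz'I, hz'O, hp.tail ?_ hz'⟩
          rw [openGraph_adj]
          refine ⟨⟨hmem.1, Finset.mk_mem_sym2_iff.2 ⟨hz, hz'⟩, ?_⟩, hne⟩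
          intro u hu
          rcases Sym2.mem_iff.1 hu with rfl | rfl
          · exact ⟨hzI, hzO⟩
          · exact ⟨hz'I, hz'O⟩
  -- summation
  have h1u : 0 ≤ 1 - μ.real A := sub_nonneg.2 measureReal_le_one
  calc (1 - μ.real A) * μ.real S
      ≤ (1 - μ.real A) * ∑ q ∈ D, μ.real (Pc q) :=
        mul_le_mul_of_nonneg_left ((measureReal_mono (μ := μ) hcover (measure_ne_top μ _)).trans
          (measureReal_biUnion_finset_le _ _)) h1u
    _ = ∑ q ∈ D, (1 - μ.real A) * μ.real (Pc q) := Finset.mul_sum _ _ _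
    _ ≤ ∑ q ∈ D, μ.real (Fev q) * μ.real (Pc q) :=
        Finset.sum_le_sum fun q _ => mul_le_mul_of_nonneg_right (hFge q) measureReal_nonneg
    _ = ∑ q ∈ D, μ.real (Fev q ∩ Pc q) := Finset.sum_congr rfl fun q _ => (hind q).symm
    _ = μ.real (⋃ q ∈ D, Fev q ∩ Pc q) :=
        (measureReal_biUnion_finset hdisj fun q _ => (hFm q).inter (hPm q)).symm
    _ ≤ μ.real ({ω | IsPivotal A e ω} ∩ S) := measureReal_mono hsub

/-- **The screening inequality for an edge `{x, y}` of `B`** (both orientations): the unoriented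
birth event is covered by the two oriented ones, which are disjoint, and `oriented` applies to
each. -/
theorem final (hx : x ∈ B) (hy : y ∈ B) (hxy : x ≠ y) {A : Set (BondConfig V)}
    (hA : ∀ ω, ω ∈ A ↔ ∃ a ∈ In, ∃ b ∈ Bd, ω ∈ openConnIn (↑B : Set V) a b) :
    (1 - (bondPercolation G p).real A) * (bondPercolation G p).real
      {ω : BondConfig V | ∃ x' y' : V, s(x, y) = s(x', y') ∧
        (∃ v ∈ In, ω \ {s(x, y)} ∈ openConnIn (↑B : Set V) x' v) ∧
        (∀ w ∈ Bd, ω \ {s(x, y)} ∉ openConnIn (↑B : Set V) x' w) ∧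
        (∃ w ∈ Bd, ω \ {s(x, y)} ∈ openConnIn (↑B : Set V) y' w) ∧
        (∀ v ∈ In, ω \ {s(x, y)} ∉ openConnIn (↑B : Set V) y' v)} ≤
      (bondPercolation G p).real {ω | IsPivotal A s(x, y) ω} := by
  set Bi : V → V → Set (BondConfig V) := fun r t =>
    {ω | (∃ v ∈ In, ω \ {s(x, y)} ∈ openConnIn (↑B : Set V) r v) ∧
      (∀ w ∈ Bd, ω \ {s(x, y)} ∉ openConnIn (↑B : Set V) r w) ∧
      (∃ w ∈ Bd, ω \ {s(x, y)} ∈ openConnIn (↑B : Set V) t w) ∧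
      (∀ v ∈ In, ω \ {s(x, y)} ∉ openConnIn (↑B : Set V) t v)}
  have h1 := oriented G p (e := s(x, y)) rfl hx hy hxy hA (S := Bi x y) fun _ => Iff.rfl
  have h2 := oriented G p (e := s(x, y)) Sym2.eq_swap hy hx hxy.symm hA (S := Bi y x)
    fun _ => Iff.rfl
  have hb1m : MeasurableSet (Bi x y) :=
    (determinedBy_birth (B := B) (In := In) (Bd := Bd) s(x, y) x y).measurableSet_of_finset
  set μ := bondPercolation G p
  set piv := {ω : BondConfig V | IsPivotal A s(x, y) ω}
  have h21 : piv ∩ Bi y x ⊆ piv \ Bi x y := fun ω hω => ⟨hω.1, fun hω1 => by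
    obtain ⟨v, hv, h⟩ := hω1.1
    exact hω.2.2.2.2 v hv h⟩
  have h1u : 0 ≤ 1 - μ.real A := sub_nonneg.2 measureReal_le_one
  suffices key : ∀ S : Set (BondConfig V), S ⊆ Bi x y ∪ Bi y x →
      (1 - μ.real A) * μ.real S ≤ μ.real piv by
    refine key _ ?_
    rintro ω ⟨x', y', hexy, h⟩
    rcases Sym2.eq_iff.1 hexy with ⟨rfl, rfl⟩ | ⟨rfl, rfl⟩
    · exact Or.inl h
    · exact Or.inr h
  intro S hS
  calc (1 - μ.real A) * μ.real S
      ≤ (1 - μ.real A) * (μ.real (Bi x y) + μ.real (Bi y x)) :=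
        mul_le_mul_of_nonneg_left ((measureReal_mono hS).trans (measureReal_union_le _ _)) h1u
    _ = (1 - μ.real A) * μ.real (Bi x y) + (1 - μ.real A) * μ.real (Bi y x) := mul_add _ _ _
    _ ≤ μ.real (piv ∩ Bi x y) + μ.real (piv ∩ Bi y x) := add_le_add h1 h2
    _ ≤ μ.real (piv ∩ Bi x y) + μ.real (piv \ Bi x y) :=
        add_le_add le_rfl (measureReal_mono (μ := μ) h21 (measure_ne_top μ _))
    _ = μ.real piv := measureReal_inter_add_sdiff hb1m

end StubScreening

/-- **Stub `stub_screening`** of line `birth-merge-ledger` (crux stmt-CriticalPhenomena-4444): the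
screening inequality `(1 - P_t(A)) · P_t(birth_e) ≤ P_t(e pivotal for A)` for the annulus-crossing
event `A = annulusCrossing d n`, every edge `e` of `Λ_{2n}` and every `t ∈ (0, 1)`, where `birth_e`
is the event that, read without `e`, the `Λ_{2n}`-cluster of one endpoint of `e` meets `Λ_n` and
misses `∂ⁱⁿΛ_{2n}` while that of the other endpoint meets `∂ⁱⁿΛ_{2n}` and misses `Λ_n`
(from `StubScreening.final`, an exploration decomposition à la Grimmett 1999 §10.3 /
Hutchcroft 2022 §2; the hypothesis `t ∈ (0, 1)` is not needed). -/
theorem stub_screening :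
    ∀ (d n : ℕ) (t : ℝ), t ∈ Set.Ioo (0 : ℝ) 1 → ∀ e ∈ edgesIn (zdGraph d) (box d (2 * n)), (1 - (bondPercolation (zdGraph d) (Set.projIcc (0 : ℝ) 1 zero_le_one t)).real (annulusCrossing d n)) * (bondPercolation (zdGraph d) (Set.projIcc (0 : ℝ) 1 zero_le_one t)).real {ω : BondConfig (Site d) | ∃ x y : Site d, e = s(x, y) ∧ (∃ v ∈ box d n, ω \ {e} ∈ openConnIn (↑(box d (2 * n)) : Set (Site d)) x v) ∧ (∀ w ∈ innerBoundary (zdGraph d) (box d (2 * n)), ω \ {e} ∉ openConnIn (↑(box d (2 * n)) : Set (Site d)) x w) ∧ (∃ w ∈ innerBoundary (zdGraph d) (box d (2 * n)), ω \ {e} ∈ openConnIn (↑(box d (2 * n)) : Set (Site d)) y w) ∧ (∀ v ∈ box d n, ω \ {e} ∉ openConnIn (↑(box d (2 * n)) : Set (Site d)) y v)} ≤ (bondPercolation (zdGraph d) (Set.projIcc (0 : ℝ) 1 zero_le_one t)).real {ω | IsPivotal (annulusCrossing d n) e ω} := by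
  intro d n t _ e he
  obtain ⟨heE, heB⟩ := mem_edgesIn_iff.1 he
  clear he
  induction e using Sym2.ind with
  | _ x y =>
    have hxy : x ≠ y := fun h =>
      SimpleGraph.not_isDiag_of_mem_edgeSet _ heE (Sym2.mk_isDiag_iff.2 h)
    exact StubScreening.final (zdGraph d) _ (heB x (Sym2.mem_mk_left x y))
      (heB y (Sym2.mem_mk_right x y)) hxy fun _ => Iff.rfl

end Summit.CriticalPhenomena.PercolationContinuityZ3.Theorems.NonProliferation

end
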